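import Summits.MatrixMultiplication.MatrixMultiplication.Theorems.AbelianSTPPCensusShapeCertVPDefs

/-!
# Abelian STPP census — kernel evaluation of the vP certificate checker `ShapeCertVP` (G: orders 300–309)

Cell mm-stpp, route `AbelianSTPPCensusVP`, crux `ShapeExclusionVP337` (stmt-MatrixMultiplication-19191); support file
(no definitions).  `ShapeCertVP.checkV M = true` by `decide +kernel` (no `native_decide`, standard axioms), ONE theorem
per order so that every kernel evaluation starts with empty caches (measured in the seat folder: ≈ 4–8 s per order below
300, ≤ 35 s at the orders 300–337 — candidate-list construction plus the `feasP` packings of the visited nodes);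
`Elab.async false` keeps the evaluations of this file sequential (one kernel computation in memory at a time; tree
precedent `NeelSignC23EK0Cert4`).  The range lemma `checkV_300_309` at the end collects the file; the ten ranges are
assembled on `128 ≤ M ≤ 337` in `AbelianSTPPCensusVPShapeExclusionVP337.lean`, where `ShapeCertVP.checkV_sound`
(`…ShapeCertVPSearch`) and the bridge `ShapeCertVP.shapeExclusionVP_of_checkV` (`…ShapeCertVPFinal`) turn them into
the crux.
-/

set_option linter.dupNamespace false -- `MatrixMultiplication.MatrixMultiplication` (summit = problem, D-0017)
set_option autoImplicit false
set_option Elab.async false -- sequential kernel evaluations (memory high-water of one order at a time)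

namespace Summit.MatrixMultiplication.MatrixMultiplication.Theorems.ShapeCertVP

set_option maxHeartbeats 0 in
/-- certificate check at order `300` (kernel evaluation) -/
theorem checkV_300 : checkV 300 = true := by
  decide +kernel

set_option maxHeartbeats 0 in
/-- certificate check at order `301` (kernel evaluation) -/
theorem checkV_301 : checkV 301 = true := by
  decide +kernel

set_option maxHeartbeats 0 in
/-- certificate check at order `302` (kernel evaluation) -/
theorem checkV_302 : checkV 302 = true := by
  decide +kernel

set_option maxHeartbeats 0 in
/-- certificate check at order `303` (kernel evaluation) -/
theorem checkV_303 : checkV 303 = true := by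
  decide +kernel

set_option maxHeartbeats 0 in
/-- certificate check at order `304` (kernel evaluation) -/
theorem checkV_304 : checkV 304 = true := by
  decide +kernel

set_option maxHeartbeats 0 in
/-- certificate check at order `305` (kernel evaluation) -/
theorem checkV_305 : checkV 305 = true := by
  decide +kernel

set_option maxHeartbeats 0 in
/-- certificate check at order `306` (kernel evaluation) -/
theorem checkV_306 : checkV 306 = true := by
  decide +kernel

set_option maxHeartbeats 0 in
/-- certificate check at order `307` (kernel evaluation) -/
theorem checkV_307 : checkV 307 = true := by
  decide +kernel

set_option maxHeartbeats 0 in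
/-- certificate check at order `308` (kernel evaluation) -/
theorem checkV_308 : checkV 308 = true := by
  decide +kernel

set_option maxHeartbeats 0 in
/-- certificate check at order `309` (kernel evaluation) -/
theorem checkV_309 : checkV 309 = true := by
  decide +kernel

/-- **The vP certificate holds at every order `300 ≤ M ≤ 309`** (collects the evaluations of this file). -/
theorem checkV_300_309 (M : ℕ) (h₁ : 300 ≤ M) (h₂ : M ≤ 309) : checkV M = true := by
  interval_cases M
  · exact checkV_300
  · exact checkV_301
  · exact checkV_302
  · exact checkV_303
  · exact checkV_304
  · exact checkV_305
  · exact checkV_306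
  · exact checkV_307
  · exact checkV_308
  · exact checkV_309

end Summit.MatrixMultiplication.MatrixMultiplication.Theorems.ShapeCertVP
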